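import Summits.HodgeConjecture.HodgeConjecture.Theorems.MarkmanPartnerTransportLowPicardRMPartneredLossless
import Summits.HodgeConjecture.HodgeConjecture.Theorems.MarkmanPartnerTransportLowPicardRMSectors
import Summits.HodgeConjecture.HodgeConjecture.Theorems.MarkmanPartnerTransportPartnerTransportEndomorphisms
import Summits.HodgeConjecture.HodgeConjecture.Theorems.MarkmanPartnerTransportLowPicardRMNLDescentX
import Summits.HodgeConjecture.HodgeConjecture.Theorems.MarkmanPartnerTransportPicardThreeK3SquaresNLAscentQuadratic

/-!
# Route MarkmanPartnerTransport · cruxes #4 `PicardThreeK3Squares` (stmt-HodgeConjecture-19652) ∕ #5 `LowPicardRealMultiplication`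
# (stmt-HodgeConjecture-19653) — «REAL-QUADRATIC FUNNEL»: modulo the displayed Noether–Lefschetz families, the whole
# real-quadratic sector of both cruxes is governed by the ORPHAN cell `(1, 2)`

The Hilbert-square link between the K3 side (`…NLAscentQuadratic`: every K3 square with real QUADRATIC multiplication is
downstream of the Picard-number-2 ones, `hCell`) and the fourfold side (`…LowPicardRMNLDescentX`: cell `(3,2)` ⟸ cell `(1,2)`):
for a projective K3 surface `S` with `¬ CM`, `¬ Scalar` (e.g. real quadratic multiplication, `ρ(S) = 2`), Beauville's marked
Hilbert square `H = S^{[2]}` (incidence `[θ]_*`, `φ_H([θ]_* a) = (η a, 0)`) is a marked `K3^{[2]}`-type fourfold which is NOT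
isometry-spanned (`exists_rmGenerator_hilbertSquare`: scalar on `T(H)` would descend to scalar on `T(S)` by
`hodgeEndomorphisms_scalar_of_partner`; CM on `H` descends to CM on `S`, `hasComplexMultiplication_of_cmx_hilbertSquare`), hence
carries an `RMgen` datum `θ_H` («RM-GEN»); a displayed absorption family `NLDescentX[H, φ_H, θ_H]` with cell-`(1,2)` residual fibres
gives HC⁴(H) (`hodgeConjectureFor_of_residualFamily_kappaClass` + `CellHC[1, 2]`), and «PARTNERED LOSSLESS»
(`hodgeConjectureFor_partnerSquare_of_hodgeConjectureFor`) carries it down to HC⁴(`S ⊗ S`).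

* `hasComplexMultiplication_of_cmx_hilbertSquare` — CM descends from `S^{[2]}` to `S` (`π ∘ Ψ ∘ [θ]_*`);
* `exists_rmGenerator_hilbertSquare` — `¬ CM S`, `¬ Scalar S` ⟹ `∃ d ≥ 2, RMgen[H, φ_H, (x,0), d]`;
* **`hodgeConjectureFor_square_of_nlDescentX_hilbertSquare`** — HC⁴(`S ⊗ S`) for a non-CM, non-scalar projective K3 surface,
  GRANTED `CellHC[1, 2]`, the displayed absorption families for the RM data of its marked Hilbert squares, and the named facts;
* **`hodgeConjectureFor_square_of_quadratic_of_cellHC_one_two`** — for EVERY projective K3 surface with `Quadratic[S]` and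
  `ρ(S) ≥ 2`: HC⁴(`S ⊗ S`) ⟸ Buskin + markings + the displayed K3-side quadratic ascent families (`…NLAscentQuadratic`) + the
  displayed X-side absorption families at `ρ(S) = 2` + **`CellHC[1, 2]`** + {Beauville incidence, O'Grady, Voisin cup, Markman
  isometry-algebraic, Verbitsky–Guan, Charles–Markman};
* `hodgeConjectureFor_square_of_rank_mem_of_cellHC_one_two` — the same for EVERY projective K3 surface with
  `ρ(S) ∈ {8, 12, 14, 16}` (real quadratic multiplication forced, `RealMultiplicationType.quadratic_of_rank`).

So, modulo displayed moduli inputs ((I1′) on both sides) and named facts, the one OPEN input of the entire real-quadratic sector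
of cruxes #4 and #5 is HC⁴ for the very general polarised `K3^{[2]}`-type fourfolds with `ρ = 1` and real quadratic
multiplication (cell `(1,2)`: no K3 partner, `T` of rank `22`). No definition, no sorry, no new named fact; credits nothing to HC.
Prover seat hodge-nonav-19652-p1 (gen 19), `--supports stmt-HodgeConjecture-19652`.

References: A. Beauville, J. Differential Geom. 18 (1983) §6 Prop. 6; E. Markman, Compos. Math. 160 (2024) Thm. 1.1; F. Charles,
E. Markman, Compos. Math. 149 (2013) Thm. 1.1; K. O'Grady, Commun. Contemp. Math. 10 (2008) §2–3; B. van Geemen, M. Schütt, Forum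
Math. Sigma 13 (2025) e2 §2.6, Prop. 3.2, §3.4; Yu. G. Zarhin, J. reine angew. Math. 341 (1983) Thm. 1.5.1; C. Voisin,
*Hodge Theory II* Thm. 4.18, §7.3.2.
-/

noncomputable section

set_option linter.dupNamespace false

open Module CategoryTheory MonoidalCategory CartesianMonoidalCategory AlgebraicGeometry Polynomial
open Literature.AlgebraicTopology.SingularHomology Literature.Geometry.Kaehler
open Literature.AlgebraicGeometry Literature.AlgebraicGeometry.Motives Literature.AlgebraicGeometry.HodgeTheory
open Literature.AlgebraicGeometry.Hyperkaehler Literature.AlgebraicGeometry.Surfaces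
open Summit.HodgeConjecture.HodgeConjecture.Theorems.NikulinTwinTransport
open Summit.HodgeConjecture.HodgeConjecture.Theorems.MarkmanPartnerTransport.BBFPositivity

namespace Summit.HodgeConjecture.HodgeConjecture.Theorems.MarkmanPartnerTransport.PartnerLattice

/-- `MarkedK3Sq[X, φ, P, z]`: VERBATIM the `let MarkedK3Sq := …` binder of the route declarations. Local notation only. -/
local notation3 (prettyPrint := false) "MarkedK3Sq[" X ", " φ ", " P ", " z "]" =>
  (((IsIntegralClass P ∧ ∀ Q : complexBetti X (2 * 4), IsIntegralClass Q → ∃ n : ℤ, Q = n • P) ∧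
    (∀ c : complexBetti X 2, IsIntegralClass c ↔ ∃ v : K3HilbertIndex → ℤ, φ c = fun i => (v i : ℂ)) ∧
    (∀ a : complexBetti X 2, cupPowTwo a 4 = ((3 : ℂ) * (k3HilbertForm 2 (φ a) (φ a)) ^ 2) • P) ∧
    (IsOfHodgeType 4 X 2 2 0 (LinearEquiv.symm φ z) ∧
      ∀ τ : complexBetti X 2, IsOfHodgeType 4 X 2 2 0 τ → ∃ t : ℂ, τ = t • LinearEquiv.symm φ z) ∧
    (∀ c : complexBetti X 2, IsOfHodgeType 4 X 2 1 1 c ↔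
      (k3HilbertForm 2 (φ c) z = 0 ∧ k3HilbertForm 2 (φ c) (star z) = 0)) ∧
    (k3HilbertForm 2 z z = 0 ∧ 0 < (k3HilbertForm 2 (star z) z).re)))

/-- `MarkedK3[S, η, p, x]`: VERBATIM the `let MarkedK3 := …` binder of the route declarations. Local notation only. -/
local notation3 (prettyPrint := false) "MarkedK3[" S ", " η ", " p ", " x "]" =>
  (p ≠ 0 ∧ (IsIntegralClass p ∧
    (∀ q : complexBetti S (2 * 2), IsIntegralClass q → ∃ n : ℤ, q = n • p) ∧
    (∀ c : complexBetti S (2 * 1), IsIntegralClass c ↔ ∃ v : K3Index → ℤ, η c = fun i => (v i : ℂ)) ∧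
    (∀ a b : complexBetti S (2 * 1),
      cupProduct (rfl : 2 * 1 + 2 * 1 = 2 * 2) a b = k3Form (η a) (η b) • p) ∧
    IsOfHodgeType 2 S (2 * 1) 2 0 (LinearEquiv.symm η x) ∧
    (∀ τ : complexBetti S (2 * 1), IsOfHodgeType 2 S (2 * 1) 2 0 τ →
      ∃ t : ℂ, τ = t • LinearEquiv.symm η x)) ∧
    (k3Form x x = 0 ∧ 0 < (k3Form (star x) x).re ∧
      ∃ u : K3Index → ℤ, k3Form (fun i => (u i : ℂ)) x = 0 ∧ 0 < ∑ i, ∑ j, u i * k3Gram i j * u j))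

/-- `SpIso[X, φ]`: VERBATIM the `let SpannedByIsometries := …` binder of the route declarations. Local notation only. -/
local notation3 (prettyPrint := false) "SpIso[" X ", " φ "]" =>
  (∀ f : complexBetti X 2 →ₗ[ℂ] complexBetti X 2, (∀ y, IsRationalClass y → IsRationalClass (f y)) →
    (∀ (i j : ℕ) y, IsOfHodgeType 4 X 2 i j y → IsOfHodgeType 4 X 2 i j (f y)) →
    (∀ d : complexBetti X 2, d ∈ algebraicClasses X 1 → f d = 0) →
    (∀ y : complexBetti X 2, ∀ d : complexBetti X 2, d ∈ algebraicClasses X 1 →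
      k3HilbertForm 2 (φ (f y)) (φ d) = 0) →
    ∃ (k : ℕ) (c : Fin k → ℚ) (g : Fin k → (complexBetti X 2 →ₗ[ℂ] complexBetti X 2)),
      (∀ i, Function.Bijective (g i) ∧ (∀ y, IsRationalClass y → IsRationalClass (g i y)) ∧
        (∀ (a b : ℕ) y, IsOfHodgeType 4 X 2 a b y → IsOfHodgeType 4 X 2 a b (g i y)) ∧
        (∀ a b, k3HilbertForm 2 (φ (g i a)) (φ (g i b)) = k3HilbertForm 2 (φ a) (φ b))) ∧
      ∀ y : complexBetti X 2, (∀ d : complexBetti X 2, d ∈ algebraicClasses X 1 →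
        k3HilbertForm 2 (φ y) (φ d) = 0) → f y = ∑ i : Fin k, ((c i : ℂ) • g i y))

/-- `RMgenWith[X, φ, z, d, θ]`: VERBATIM `…LowPicardRMNLDescentX` (the body of `RMgen` for a given `θ`). Local notation only. -/
local notation3 (prettyPrint := false) "RMgenWith[" X ", " φ ", " z ", " d ", " θ "]" =>
  ((∀ y, IsRationalClass y → IsRationalClass (θ y)) ∧
    (∀ (i j : ℕ) y, IsOfHodgeType 4 X 2 i j y → IsOfHodgeType 4 X 2 i j (θ y)) ∧
    (∀ y w : complexBetti X 2, k3HilbertForm 2 (φ (θ y)) (φ w) = k3HilbertForm 2 (φ y) (φ (θ w))) ∧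
    ∃ ev : ℂ, θ (LinearEquiv.symm φ z) = ev • LinearEquiv.symm φ z ∧ ev.im = 0 ∧
      (minpoly ℚ ev).natDegree = d ∧
      (∃ n : ℕ, 3 ≤ n ∧ d * n + Module.finrank ℂ ↥(algebraicClasses X 1) = 23) ∧
      ∀ f : complexBetti X 2 →ₗ[ℂ] complexBetti X 2, (∀ y, IsRationalClass y → IsRationalClass (f y)) →
        (∀ (i j : ℕ) y, IsOfHodgeType 4 X 2 i j y → IsOfHodgeType 4 X 2 i j (f y)) →
        ∃ c : Fin d → ℚ, ∀ y : complexBetti X 2,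
          (∀ a : complexBetti X 2, a ∈ algebraicClasses X 1 → k3HilbertForm 2 (φ y) (φ a) = 0) →
            f y = ∑ i : Fin d, ((c i : ℂ) • (θ ^ (i : ℕ)) y))

/-- `RMgen[X, φ, z, d]`: VERBATIM `…LowPicardRMCells`. Local notation only. -/
local notation3 (prettyPrint := false) "RMgen[" X ", " φ ", " z ", " d "]" =>
  (∃ θ : complexBetti X 2 →ₗ[ℂ] complexBetti X 2, RMgenWith[X, φ, z, d, θ])

/-- `CellHC[ρ, d]`: VERBATIM `…LowPicardRMCells`. Local notation only. -/
local notation3 (prettyPrint := false) "CellHC[" ρ ", " d "]" =>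
  (∀ (X : SchemeOver ℂ), IsSmoothProjective 4 X → IsOfK3HilbertSquareType X →
    ∀ (φ : complexBetti X 2 ≃ₗ[ℂ] (K3HilbertIndex → ℂ)) (P : complexBetti X (2 * 4)) (z : K3HilbertIndex → ℂ),
      MarkedK3Sq[X, φ, P, z] → ¬ SpIso[X, φ] → Module.finrank ℂ ↥(algebraicClasses X 1) = ρ →
        RMgen[X, φ, z, d] → HodgeConjectureFor 4 X)

/-- `Kap[φ, g]`: VERBATIM the kappa class of `…KappaClassHodge`. Local notation only. -/
local notation3 (prettyPrint := false) "Kap[" φ ", " g "]" =>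
  (∑ i : K3HilbertIndex, ∑ j : K3HilbertIndex,
    (((k3HilbertGram 2).map (Int.cast : ℤ → ℂ))⁻¹ i j) •
      cupProduct (rfl : 2 + 2 = 2 * 2) ((LinearEquiv.symm φ) (Pi.single i 1))
        (g ((LinearEquiv.symm φ) (Pi.single j 1))))

/-- `NLDescentX[X, φ, θ]`: VERBATIM `…LowPicardRMNLDescentX` (the displayed absorption family). Local notation only.
[cite: GeemenSchutt2023, §2.6, Prop. 3.2 and §3.4] [cite: VoisinHodgeII2003, §5.3.4 and §7.3.2] -/
local notation3 (prettyPrint := false) "NLDescentX[" X ", " φ ", " θ "]" =>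
  (∃ w : complexBetti X (2 * 2), w ∈ algebraicClasses X 2 ∧
    ∃ (𝒳 B : SchemeOver ℂ) (g : 𝒳 ⟶ B),
      IsSmoothProjectiveFamily g 4 ∧ IsQuasiProjectiveOver 𝒳 ∧ IsQuasiProjectiveOver B ∧
      AlgebraicGeometry.Smooth B.hom ∧ IrreducibleSpace B.left ∧
      ∃ (σ : ComplexPoints B → FiberClass g (2 * 2)) (hpt : ∀ b, (σ b).pt = b), Continuous σ ∧
      ∃ (b₁ : ComplexPoints B) (e₁ : X ≅ fiberOver g b₁),
        complexBetti.map e₁.hom (2 * 2) ((σ b₁).clsAt (hpt b₁)) = Kap[φ, θ] + w ∧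
        ∀ᶠ b in residual (ComplexPoints B),
          IsRationalClass ((σ b).clsAt (hpt b)) ∧
          IsOfHodgeType 4 (fiberOver g b) (2 * 2) 2 2 ((σ b).clsAt (hpt b)) ∧
          ∃ (X' : SchemeOver ℂ) (_ : fiberOver g b ≅ X') (_ : IsSmoothProjective 4 X') (_ : IsOfK3HilbertSquareType X')
            (φ' : complexBetti X' 2 ≃ₗ[ℂ] (K3HilbertIndex → ℂ)) (P' : complexBetti X' (2 * 4)) (z' : K3HilbertIndex → ℂ),
            MarkedK3Sq[X', φ', P', z'] ∧ ¬ SpIso[X', φ'] ∧ Module.finrank ℂ ↥(algebraicClasses X' 1) = 1 ∧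
            RMgen[X', φ', z', 2])

/-- `Scalar[S]`: VERBATIM the scalar clause of `…NLAscent` ∕ `…RealMultiplicationType`. Local notation only. -/
local notation3 (prettyPrint := false) "Scalar[" S "]" =>
  (∀ (f : complexBetti S (2 * 1) →ₗ[ℂ] complexBetti S (2 * 1)),
    (∀ y, IsRationalClass y → IsRationalClass (f y)) →
    (∀ (i j : ℕ) y, IsOfHodgeType 2 S (2 * 1) i j y → IsOfHodgeType 2 S (2 * 1) i j (f y)) →
    (∀ d ∈ algebraicClasses S 1, f d = 0) →
    (∀ y : complexBetti S (2 * 1), ∀ d ∈ algebraicClasses S 1,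
      cupProduct (rfl : 2 * 1 + 2 * 1 = 2 * 2) (f y) d = 0) →
    ∃ a : ℚ, ∀ y : complexBetti S (2 * 1),
      (∀ d ∈ algebraicClasses S 1, cupProduct (rfl : 2 * 1 + 2 * 1 = 2 * 2) y d = 0) →
        f y = (a : ℂ) • y)

/-- `DescH[S]`: **the displayed absorption families for the Hilbert squares of `S`** — for every marking `(η, p, x)` of `S`,
every marked smooth projective `K3^{[2]}`-type `(H, φ_H, P_H, (x,0))` with an algebraic incidence `θ` from `S`
(`φ_H([θ]_* a) = (η a, 0)`), and every `RMgen` datum `θ_H` of `H`: `NLDescentX[H, φ_H, θ_H]`. Local notation only. -/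
local notation3 (prettyPrint := false) "DescH[" S "]" =>
  (∀ (η : complexBetti S (2 * 1) ≃ₗ[ℂ] (K3Index → ℂ)) (p : complexBetti S (2 * 2)) (x : K3Index → ℂ), MarkedK3[S, η, p, x] →
    ∀ (H : SchemeOver ℂ) (hH : IsSmoothProjective 4 H), IsOfK3HilbertSquareType H →
    ∀ (φH : complexBetti H 2 ≃ₗ[ℂ] (K3HilbertIndex → ℂ)) (PH : complexBetti H (2 * 4)),
      MarkedK3Sq[H, φH, PH, Sum.elim x 0] → ∀ (hS2 : IsSmoothProjective 2 S),
      ∀ θ ∈ algebraicClasses (H ⊗ S) 2,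
        (∀ a : complexBetti S (2 * 1),
          φH (corrAction complexOrientationFamily hH hS2 (rfl : 2 * 1 + 2 * 2 = 2 + 2 * 2) θ a) = Sum.elim (η a) 0) →
        ∀ (d : ℕ) (θH : complexBetti H 2 →ₗ[ℂ] complexBetti H 2), RMgenWith[H, φH, Sum.elim x 0, d, θH] →
          NLDescentX[H, φH, θH])

variable {S H : SchemeOver ℂ} {η : complexBetti S (2 * 1) ≃ₗ[ℂ] (K3Index → ℂ)} {p : complexBetti S (2 * 2)}
  {x : K3Index → ℂ} {φH : complexBetti H 2 ≃ₗ[ℂ] (K3HilbertIndex → ℂ)} {PH : complexBetti H (2 * 4)}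

/-! ### CM and `RMgen` on the Hilbert square -/

/-- **Complex multiplication descends from the Hilbert square**: a rational, `(1,1)`-preserving endomorphism `Ψ` of `H²(H)`
with a NON-REAL eigenvalue on `σ_H = φ_H⁻¹(x,0)` gives `HasComplexMultiplication S`, via `π ∘ Ψ ∘ [θ]_*` (`π` the
Beauville–Bogomolov retraction; eigenvalues `μ` on `σ = η⁻¹x` and `\bar μ` on `σ̄`, `apply_conjPeriod_of_apply_period`).
[cite: Beauville1983, §6 Prop. 6] [cite: Zarhin1983HodgeGroupsK3, Thm. 1.5.1] -/
theorem hasComplexMultiplication_of_cmx_hilbertSquare (hS : IsK3Surface S) (hMS : MarkedK3[S, η, p, x])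
    (hH : IsSmoothProjective 4 H) (hMH : MarkedK3Sq[H, φH, PH, Sum.elim x 0])
    {i : complexBetti S (2 * 1) →ₗ[ℂ] complexBetti H 2} (hirat : ∀ a, IsRationalClass a → IsRationalClass (i a))
    (hi : ∀ a, φH (i a) = Sum.elim (η a) 0)
    {Ψ : complexBetti H 2 →ₗ[ℂ] complexBetti H 2} (hΨrat : ∀ y, IsRationalClass y → IsRationalClass (Ψ y))
    (hΨ11 : ∀ y, IsOfHodgeType 4 H 2 1 1 y → IsOfHodgeType 4 H 2 1 1 (Ψ y)) {μ : ℂ} (hμ : μ.im ≠ 0)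
    (hΨσ : Ψ (LinearEquiv.symm φH (Sum.elim x 0)) = μ • LinearEquiv.symm φH (Sum.elim x 0)) :
    HasComplexMultiplication S := by
  obtain ⟨hp0, ⟨-, -, hηint, hcupS, h20, h20span⟩, -, hxpos, -⟩ := hMS
  obtain ⟨-, hintH, -, -, -, -⟩ := id hMH
  have hHT : Huybrechts_K3_hodgeTypes_H2 := Huybrechts_K3_hodgeTypes_H2_holds
  set σ := η.symm x with hσdef
  have hxne : σ ≠ 0 := fun h0 => ne_zero_of_star_self_re_pos hxpos (by simpa [hσdef] using congrArg η h0)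
  have hσbar : conjClass (ComplexPoints S) (2 * 1) σ = η.symm (star x) := conjClass_marking_symm η hηint x
  -- the retraction `π` and the descended endomorphism `Ψ_S := π ∘ Ψ ∘ i`
  let π : complexBetti H 2 →ₗ[ℂ] complexBetti S (2 * 1) :=
    (η.symm : (K3Index → ℂ) →ₗ[ℂ] complexBetti S (2 * 1)) ∘ₗ
      LinearMap.funLeft ℂ ℂ (Sum.inl : K3Index → K3HilbertIndex) ∘ₗ (φH : complexBetti H 2 →ₗ[ℂ] (K3HilbertIndex → ℂ))
  have hπ : ∀ w, π w = η.symm (fun k => φH w (Sum.inl k)) := fun w => rfl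
  let ΨS : complexBetti S (2 * 1) →ₗ[ℂ] complexBetti S (2 * 1) := π ∘ₗ Ψ ∘ₗ i
  have hΨS : ∀ a, ΨS a = η.symm (fun k => φH (Ψ (i a)) (Sum.inl k)) := fun a => rfl
  have hiσ : i σ = φH.symm (Sum.elim x 0) := by
    apply φH.injective
    rw [hi, hσdef, LinearEquiv.apply_symm_apply, LinearEquiv.apply_symm_apply]
  have hstar : star (Sum.elim x (0 : Unit → ℂ)) = Sum.elim (star x) 0 := by
    funext k; rcases k with k | k <;> simp
  have hiσbar : i (η.symm (star x)) = φH.symm (star (Sum.elim x 0)) := by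
    apply φH.injective
    rw [hi, LinearEquiv.apply_symm_apply, LinearEquiv.apply_symm_apply, hstar]
  -- eigenvalues on `σ`, `σ̄`
  have hΨSσ : ΨS σ = μ • σ := by
    rw [hΨS, hiσ, hΨσ, map_smul, LinearEquiv.apply_symm_apply, hσdef, ← map_smul]
    congr 1
  have hΨSσbar : ΨS (conjClass (ComplexPoints S) (2 * 1) σ) = starRingEnd ℂ μ • conjClass (ComplexPoints S) (2 * 1) σ := by
    rw [hσbar, hΨS, hiσbar, apply_conjPeriod_of_apply_period hH hMH Ψ hΨrat hΨ11 hΨσ, hstar, ← map_smul]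
    congr 1
  -- rationality and Hodge types of `Ψ_S`
  have hΨSrat : ∀ a, IsRationalClass a → IsRationalClass (ΨS a) := fun a ha => by
    rw [hΨS]
    exact isRationalClass_retraction hS hH hηint hintH (hΨrat _ (hirat a ha))
  have hΨStyp : ∀ (a b : ℕ) y, IsOfHodgeType 2 S (2 * 1) a b y → IsOfHodgeType 2 S (2 * 1) a b (ΨS y) := by
    refine typePreserving_of_lines hHT hS h20 hxne ΨS ⟨μ, hΨSσ⟩ ⟨starRingEnd ℂ μ, hΨSσbar⟩ fun v hv => ?_
    rw [hΨS]
    exact retraction_oneOne hS hp0 hηint hcupS h20 hxpos hMH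
      (hΨ11 _ (incidence_oneOne hS hp0 hηint hcupS h20 hxpos hMH hi hv))
  exact ⟨ΨS, hΨSrat, hΨStyp, σ, μ, h20, hxne, hμ, hΨSσ⟩

/-- **The Hilbert square of a non-CM, non-scalar K3 surface carries an `RMgen` datum**: by the EXHAUSTION
`scalarOnTranscendental_or_cm_or_exists_rmGenerator` on `(H, φ_H, P_H, (x,0))`, scalar on `T(H)` would make `S` scalar
(`hodgeEndomorphisms_scalar_of_partner` along the incidence, `partner_incidence`) and CM on `H` would make `S` CM
(`hasComplexMultiplication_of_cmx_hilbertSquare`). [cite: Zarhin1983HodgeGroupsK3, Thm. 1.5.1 and Thm. 1.6]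
[cite: Beauville1983, §6 Prop. 6] [cite: Vangeemen2008, Lemma 3.2] -/
theorem exists_rmGenerator_hilbertSquare (hcup : Voisin2003_cupProduct_algebraicClasses) (hS : IsK3Surface S)
    (hMS : MarkedK3[S, η, p, x]) (hCM : ¬ HasComplexMultiplication S) (hQ : ¬ Scalar[S])
    (hH : IsSmoothProjective 4 H) (hMH : MarkedK3Sq[H, φH, PH, Sum.elim x 0])
    {θ : complexBetti (H ⊗ S) (2 * 2)} (hθ : θ ∈ algebraicClasses (H ⊗ S) 2)
    (hi : ∀ a : complexBetti S (2 * 1),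
      φH (corrAction complexOrientationFamily hH (IsK3Surface.isSmoothProjective hS)
        (rfl : 2 * 1 + 2 * 2 = 2 + 2 * 2) θ a) = Sum.elim (η a) 0) :
    ∃ d : ℕ, 2 ≤ d ∧ RMgen[H, φH, Sum.elim x 0, d] := by
  obtain ⟨hp0, ⟨hpint, hpgen, hηint, hcupS, h20, h20span⟩, hxx, hxpos, hu⟩ := id hMS
  have hμ := hasPoincareDuality_complexOrientationFamily
  obtain ⟨hg1, hg2, hg5⟩ := partner_incidence hS hp0 hηint hcupS h20 h20span hxpos hH hMH hi
  rcases scalarOnTranscendental_or_cm_or_exists_rmGenerator hH hMH with hsc | ⟨Ψ, hΨrat, hΨ11, μ', hμ', hΨσ⟩ | hR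
  · exact absurd (hodgeEndomorphisms_scalar_of_partner hcup hμ hH hMH hS hp0 hηint hcupS h20 h20span hxpos hH hMH hθ hi
      hg1 hg2 hg5 hsc) hQ
  · exact absurd (hasComplexMultiplication_of_cmx_hilbertSquare hS hMS hH hMH hg1 hi hΨrat hΨ11 hμ' hΨσ) hCM
  · exact hR

/-! ### HC⁴(S × S) through the Hilbert square and cell `(1,2)` -/

/-- **HC⁴(`S ⊗ S`) for a non-CM, non-scalar projective K3 surface, from `CellHC[1, 2]` and the displayed absorption families of
its Hilbert squares.** GRANTED the named facts {Beauville incidence, markings, O'Grady, Voisin cup, Markman isometry-algebraic,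
Verbitsky–Guan, Charles–Markman}, `DescH[S]` (moduli input (I1′-X): exists, by the sign-flipped lattice lemma, when `S^{[2]}`
lies in cell `(3,2)`, i.e. `ρ(S) = 2` with real quadratic multiplication) and HC⁴ on the orphan cell `(1,2)`:
`HodgeConjectureFor 4 (S ⊗ S)`. Chain: Beauville's `H` (`exists_rmGenerator_hilbertSquare` ⟹ `RMgen` datum `θ_H`) ⟹ HC⁴(H)
(`hodgeConjectureFor_of_residualFamily_kappaClass`, residual fibres in cell `(1,2)`) ⟹ HC⁴(`S ⊗ S`)
(`hodgeConjectureFor_partnerSquare_of_hodgeConjectureFor`). [cite: Beauville1983, §6 Prop. 6] [cite: Markman2024, §1.1 Thm. 1.1]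
[cite: CharlesMarkman2013, Thm. 1.1] [cite: GeemenSchutt2023, §2.6, Prop. 3.2 and §3.4] -/
theorem hodgeConjectureFor_square_of_nlDescentX_hilbertSquare (hBI : Beauville1983_hilbertSquare_markedIncidence)
    (hmark : Huybrechts_K3_marking_exists) (hO : OGrady2008_dualBBFClass_algebraic)
    (hcup : Voisin2003_cupProduct_algebraicClasses) (hMkI : Markman2024_rationalHodgeIsometry_algebraic_marked)
    (hV : VerbitskyGuan_cohomology_K3HilbertSquareType) (hCMk : CharlesMarkman2013_lefschetzStandard_K3HilbertType)
    (hS : IsK3Surface S) (hCM : ¬ HasComplexMultiplication S) (hQ : ¬ Scalar[S]) (hDesc : DescH[S]) (h12 : CellHC[1, 2]) :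
    HodgeConjectureFor 4 (S ⊗ S) := by
  obtain ⟨η, p, x, hp0, hmk, hxx, hxpos, hu⟩ := hmark S hS
  have hμ := hasPoincareDuality_complexOrientationFamily
  obtain ⟨H, hH, Ξ, φH, PH, -, hHK, hMH, θ, hθ, hi⟩ := hBI complexOrientationFamily hμ S hS η p x hmk hxx hxpos hu
  have hMS : MarkedK3[S, η, p, x] := ⟨hp0, hmk, hxx, hxpos, hu⟩
  obtain ⟨-, -, hηint, hcupS, h20, h20span⟩ := id hmk
  obtain ⟨d, -, θH, hθH⟩ := exists_rmGenerator_hilbertSquare hcup hS hMS hCM hQ hH hMH hθ hi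
  obtain ⟨hθ_rat, hθ_typ, hθ_sa, ev, hev, hevim, hdeg, hn, hgenθ⟩ := id hθH
  obtain ⟨w, hw, 𝒳, B, g, hg, h𝒳, hBq, hBsm, hirr, σ, hpt, hσ, b₁, e₁, hval, hres⟩ :=
    hDesc η p x hMS H hH hHK φH PH hMH (IsK3Surface.isSmoothProjective hS) θ hθ hi d θH hθH
  haveI := hirr
  have hHC : HodgeConjectureFor 4 H := by
    refine hodgeConjectureFor_of_residualFamily_kappaClass hV hO hCMk hH hHK hMH θH hθ_rat hθ_typ hθ_sa ?_ g hg h𝒳 hBq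
      hBsm σ hσ hpt b₁ e₁ hw hval ?_ ?_ ?_
    · intro f hf_rat hf_typ _ _
      obtain ⟨c, hc⟩ := hgenθ f hf_rat hf_typ
      exact ⟨d, c, hc⟩
    · filter_upwards [hres] with b hb
      obtain ⟨-, -, X', e', hX', hK', φ', P', z', hM', hnsp', hρ', hR'⟩ := hb
      exact (hodgeConjectureFor_iff_of_iso' e').2 (h12 X' hX' hK' φ' P' z' hM' hnsp' hρ' hR')
    · filter_upwards [hres] with b hb
      exact hb.1
    · filter_upwards [hres] with b hb
      exact hb.2.1
  exact hodgeConjectureFor_partnerSquare_of_hodgeConjectureFor hBI hO hcup hMkI hV hCMk hmark hH hHK hMH ⟨θH, hθH⟩ hS hMS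
    (partner_incidence hS hp0 hηint hcupS h20 h20span hxpos hH hMH hi) hHC

end Summit.HodgeConjecture.HodgeConjecture.Theorems.MarkmanPartnerTransport.PartnerLattice

end
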